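import Summits.KontsevichZagierPeriods.KontsevichZagierPeriods.Theorems.SymplecticScissorsRealOnePeriodRelationsStubHomotopyInvarianceAux
import Summits.KontsevichZagierPeriods.KontsevichZagierPeriods.Theorems.GammaHodgeSector.Negative.Algebraicity
import Summits.KontsevichZagierPeriods.KontsevichZagierPeriods.Theorems.HermiteRigidityGenusTwoCycleTransferPushforwardDimOne
import Literature.NumberTheory.Transcendental.CurvePeriodsGridProofs

/-!
# `RealOnePeriodRelations` (stmt-KontsevichZagierPeriods-10042), line `nash-retraction-thin-strip`,
# stub `stub_homotopyInvariance` — auxiliary file 2: algebraic values, grid pieces, the sides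

Helpers for the stub `stub_homotopyInvariance` (homotopy coherence in the move world), continued
(registered anchor: `helper_homotopyInvariance_2`):

* a `ℚ`-semialgebraic path takes ALGEBRAIC values at rational times (`isAlgebraic_apply_of_sa`,
  from `GammaHodgeSectorNegative.isAlgebraic_apply_ratCast`: a `ℚ`-semialgebraic function of one
  variable takes algebraic values at rational points), so the grid values `γ(q/N)` of the two side
  paths of a homotopy are algebraic points and the grid pieces `t ↦ γ(q/N + t/N)` are semialgebraic
  `C¹` paths with algebraic end points (`sa_piece`);
* THE SIDES OF THE GRID: a realisation `[∫₀¹ Re(a·ω(γ)γ′)]` is congruent modulo `M₁` to the sum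
  of the realisations of its `N` grid pieces (`of_sub_sum_pieces_mem`): split the domain `(0,1)` at
  the null cut points `q/N` (rule 1a, `of_sub_sum_restrict_mem`) and push each piece forward along
  the affine map `t ↦ N t − q` (rule 2 in dimension one, `stub_pushforwardDimOne` of the route
  `HermiteRigidity`; the chain rule `d/du γ(q/N + u/N) = γ′/N` matches the Jacobian `1/|φ′| = 1/N`).

References: M. Kontsevich, D. Zagier, *Periods* (2001), §1.2 rules (1), (2); J. Bochnak, M. Coste,
M.-F. Roy, *Real Algebraic Geometry* (1998), §2.2.
-/

noncomputable section

open scoped BigOperators Topology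
open Set MeasureTheory Filter
open Literature.NumberTheory.Transcendental Literature.NumberTheory.Transcendental.CurvePeriods
open Literature.ModelTheory.ExponentialFields (IsSemialgebraic isSemialgebraic_setOf_eval_pos)
open Summit.KontsevichZagierPeriods.SymplecticScissors.RealOnePeriodRelationsNegative
  (M₁ unitDom isSemialgebraic_unitDom)
open Summit.KontsevichZagierPeriods.Theorems.StuffleInKZ.Negative.LogShadow (isSemialgebraic_Icc01)

namespace Summit.KontsevichZagierPeriods.SymplecticScissors.RealOnePeriodRelations.HomotopyInvariance

/-! ## Algebraic values of semialgebraic paths at rational times -/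

/-- **A `ℚ`-semialgebraic path takes algebraic values at rational times** (a `ℚ`-semialgebraic
function of one variable takes algebraic values at rational points: `isAlgebraic_apply_ratCast`).
[cite: BochnakCosteRoy1998, §2.2] -/
theorem isAlgebraic_apply_of_sa {n : ℕ} {e : ℝ → (Fin n → ℂ)}
    (h : IsSemialgebraicMapOn ℚ {z : Fin 1 → ℝ | z 0 ∈ Set.Icc (0 : ℝ) 1}
      (fun z => Fin.append (fun i => (e (z 0) i).re) (fun i => (e (z 0) i).im)))
    {q : ℚ} (hq : (q : ℝ) ∈ Icc (0 : ℝ) 1) (i : Fin n) : IsAlgebraic ℚ (e q i) := by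
  obtain ⟨hre, him⟩ := sa_re_im h i
  have hz : (fun _ : Fin 1 => ((q : ℚ) : ℝ)) ∈ {z : Fin 1 → ℝ | z 0 ∈ Set.Icc (0 : ℝ) 1} := hq
  have h1 := GammaHodgeSectorNegative.isAlgebraic_apply_ratCast hre (fun _ => q) hz
  have h2 := GammaHodgeSectorNegative.isAlgebraic_apply_ratCast him (fun _ => q) hz
  have h3 : IsAlgebraic ℚ (((e q i).re : ℂ) + ((e q i).im : ℂ) * Complex.I) :=
    (h1.algebraMap (A := ℂ)).add ((h2.algebraMap (A := ℂ)).mul KoblitzOgus.isAlgebraic_I)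
  rwa [Complex.re_add_im] at h3

/-! ## Grid pieces of a semialgebraic path -/

/-- `(a, b) ⊂ ℝ¹` with rational end points is `ℚ`-semialgebraic. [folklore] -/
theorem isSemialgebraic_IooSet (a b : ℚ) :
    IsSemialgebraic ℚ {z : Fin 1 → ℝ | z 0 ∈ Ioo (a : ℝ) b} := by
  have h1 := isSemialgebraic_setOf_eval_pos (k := ℚ) (R := ℝ)
    (MvPolynomial.X (0 : Fin 1) - MvPolynomial.C a : MvPolynomial (Fin 1) ℚ)
  have h2 := isSemialgebraic_setOf_eval_pos (k := ℚ) (R := ℝ)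
    (MvPolynomial.C b - MvPolynomial.X (0 : Fin 1) : MvPolynomial (Fin 1) ℚ)
  have h3 : {z : Fin 1 → ℝ | z 0 ∈ Ioo (a : ℝ) b} =
      {x | 0 < MvPolynomial.aeval x (MvPolynomial.X (0 : Fin 1) - MvPolynomial.C a :
          MvPolynomial (Fin 1) ℚ)} ∩
        {x | 0 < MvPolynomial.aeval x (MvPolynomial.C b - MvPolynomial.X (0 : Fin 1) :
          MvPolynomial (Fin 1) ℚ)} := by
    ext z
    simp [sub_pos]
  rw [h3]
  exact h1.inter h2

/-- The grid piece `t ↦ γ(q/N + t/N)` of a semialgebraic path is semialgebraic (composition with an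
affine map over `ℚ`). [cite: BochnakCosteRoy1998, Prop. 2.2.6] -/
theorem sa_piece {n : ℕ} {e : ℝ → (Fin n → ℂ)}
    (h : IsSemialgebraicMapOn ℚ {z : Fin 1 → ℝ | z 0 ∈ Set.Icc (0 : ℝ) 1}
      (fun z => Fin.append (fun i => (e (z 0) i).re) (fun i => (e (z 0) i).im)))
    {N : ℕ} (hN : 0 < N) {q : ℕ} (hq : q < N) :
    IsSemialgebraicMapOn ℚ {z : Fin 1 → ℝ | z 0 ∈ Set.Icc (0 : ℝ) 1}
      (fun z => Fin.append (fun i => (e ((q : ℝ) / N + z 0 / N) i).re)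
        (fun i => (e ((q : ℝ) / N + z 0 / N) i).im)) := by
  set A : (Fin 1 → ℝ) → (Fin 1 → ℝ) := fun z _ => (q : ℝ) / N + z 0 / N with hA
  have hAsa : IsSemialgebraicMapOn ℚ {z : Fin 1 → ℝ | z 0 ∈ Set.Icc (0 : ℝ) 1} A := by
    refine (isSemialgebraicMapOn_aeval isSemialgebraic_Icc01
      (fun _ : Fin 1 => (MvPolynomial.C ((q : ℚ) / N) + MvPolynomial.C ((1 : ℚ) / N) *
        MvPolynomial.X (0 : Fin 1) : MvPolynomial (Fin 1) ℚ))).congr fun z _ => ?_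
    funext j
    simp only [hA, map_add, map_mul, MvPolynomial.aeval_C, MvPolynomial.aeval_X, eq_ratCast]
    push_cast
    ring
  have hmaps : MapsTo A {z : Fin 1 → ℝ | z 0 ∈ Set.Icc (0 : ℝ) 1}
      {z : Fin 1 → ℝ | z 0 ∈ Set.Icc (0 : ℝ) 1} := fun z hz => div_add_div_mem_Icc hN hq hz
  exact IsSemialgebraicMapOn.comp_holds h hAsa hmaps

/-! ## The pieces of a realisation (rule 1a and the affine rule 2) -/

/-- The sub-interval `(q/N, (q+1)/N)` lies in `(0,1)` for `q < N`. [folklore] -/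
theorem IooSet_piece_subset {N : ℕ} (hN : 0 < N) {q : ℕ} (hq : q < N) :
    {z : Fin 1 → ℝ | z 0 ∈ Ioo ((q : ℝ) / N) (((q : ℝ) + 1) / N)} ⊆
      {z : Fin 1 → ℝ | z 0 ∈ Ioo (0 : ℝ) 1} := by
  intro z hz
  have hN' : (0 : ℝ) < N := by exact_mod_cast hN
  have hq' : (q : ℝ) + 1 ≤ N := by exact_mod_cast hq
  have h0 : (0 : ℝ) ≤ (q : ℝ) / N := by positivity
  have h1 : ((q : ℝ) + 1) / N ≤ 1 := (div_le_one hN').mpr hq'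
  exact ⟨h0.trans_lt hz.1, hz.2.trans_le h1⟩

/-- **Splitting a representation on `(0,1)` into `N` pieces** (rule 1a, `N − 1` times, the cut
points being null): `[r] − Σ_{q<N} [r|_{(q/N,(q+1)/N)}] ∈ M₁`. [cite: KontsevichZagier2001, §1.2 rule (1)] -/
theorem of_sub_sum_restrict_mem (r : KZ.IntegralRep 1) (hr : r.domain = {z | z 0 ∈ Set.Ioo (0 : ℝ) 1})
    {N : ℕ} (hN : 0 < N)
    (hsa : ∀ q : ℕ, IsSemialgebraic ℚ {z : Fin 1 → ℝ | z 0 ∈ Ioo ((q : ℝ) / N) (((q : ℝ) + 1) / N)})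
    (hsub : ∀ q, q < N → {z : Fin 1 → ℝ | z 0 ∈ Ioo ((q : ℝ) / N) (((q : ℝ) + 1) / N)} ⊆ r.domain)
    (piece : ℕ → KZ.IntegralRep 1)
    (hpiece : ∀ q (hq : q < N), piece q = r.restrict _ (hsa q) (hsub q hq)) :
    KZ.of r - ∑ q ∈ Finset.range N, KZ.of (piece q) ∈ M₁ := by
  have hN' : (0 : ℝ) < N := by exact_mod_cast hN
  -- the initial segments `D m = (0, m/N)`
  have hDsa : ∀ m : ℕ, IsSemialgebraic ℚ {z : Fin 1 → ℝ | z 0 ∈ Ioo (0 : ℝ) ((m : ℝ) / N)} := by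
    intro m
    have := isSemialgebraic_IooSet 0 ((m : ℚ) / N)
    push_cast at this
    exact this
  have hDsub : ∀ m, m ≤ N → {z : Fin 1 → ℝ | z 0 ∈ Ioo (0 : ℝ) ((m : ℝ) / N)} ⊆ r.domain := by
    intro m hm z hz
    rw [hr]
    exact ⟨hz.1, hz.2.trans_le ((div_le_one hN').mpr (by exact_mod_cast hm))⟩
  have hind : ∀ m (hm : m ≤ N), KZ.of (r.restrict _ (hDsa m) (hDsub m hm)) -
      ∑ q ∈ Finset.range m, KZ.of (piece q) ∈ M₁ := by
    intro m
    induction m with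
    | zero =>
      intro _
      rw [Finset.sum_range_zero, sub_zero]
      refine of_mem_of_volume_zero _ ?_
      show volume {z : Fin 1 → ℝ | z 0 ∈ Ioo (0 : ℝ) (((0 : ℕ) : ℝ) / N)} = 0
      rw [Nat.cast_zero, zero_div, Ioo_self]
      simp
    | succ m ih =>
      intro hm
      have hm' : m < N := Nat.lt_of_succ_le hm
      have hstep : KZ.of (r.restrict _ (hDsa (m + 1)) (hDsub (m + 1) hm)) -
          KZ.of (r.restrict _ (hDsa m) (hDsub m hm'.le)) - KZ.of (piece m) ∈ M₁ := by
        rw [hpiece m hm']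
        refine of_sub_sub_mem_of_cover _ _ _ (fun z hz => ?_) (fun z hz => ?_) (fun _ _ => rfl)
          (fun _ _ => rfl) ?_ ?_
        · show z 0 ∈ Ioo (0 : ℝ) (((m + 1 : ℕ) : ℝ) / N)
          have hz' : z 0 ∈ Ioo (0 : ℝ) ((m : ℝ) / N) := hz
          push_cast
          exact ⟨hz'.1, hz'.2.trans_le (div_le_div_of_nonneg_right (by linarith) hN'.le)⟩
        · show z 0 ∈ Ioo (0 : ℝ) (((m + 1 : ℕ) : ℝ) / N)
          have hz' : z 0 ∈ Ioo ((m : ℝ) / N) (((m : ℝ) + 1) / N) := hz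
          push_cast
          exact ⟨lt_of_le_of_lt (by positivity) hz'.1, hz'.2⟩
        · refine measure_mono_null (fun z hz => ?_) (measure_empty (μ := volume))
          have h1 : z 0 ∈ Ioo (0 : ℝ) ((m : ℝ) / N) := hz.1
          have h2 : z 0 ∈ Ioo ((m : ℝ) / N) (((m : ℝ) + 1) / N) := hz.2
          exact absurd (h1.2.trans h2.1) (lt_irrefl _)
        · -- the cut point `{z | z 0 = m/N}` is null (cf. `MzvKernelInKZ.Negative.volume_pt1`)
          have hnull : volume {z : Fin 1 → ℝ | z 0 = (m : ℝ) / N} = 0 := by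
            rw [show {z : Fin 1 → ℝ | z 0 = (m : ℝ) / N} = Set.pi univ fun _ => {(m : ℝ) / N} from
              by ext z; simp [Fin.forall_fin_one], volume_pi_pi]
            simp
          refine measure_mono_null (fun z hz => ?_) hnull
          have h0 : z 0 ∈ Ioo (0 : ℝ) (((m + 1 : ℕ) : ℝ) / N) := hz.1
          have h12 := hz.2
          simp only [mem_union, not_or] at h12
          push_cast at h0
          show z 0 = (m : ℝ) / N
          rcases lt_trichotomy (z 0) ((m : ℝ) / N) with hlt | heq | hgt
          · exact absurd ⟨h0.1, hlt⟩ h12.1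
          · exact heq
          · exact absurd ⟨hgt, h0.2⟩ h12.2
      have := M₁.add_mem hstep (ih hm'.le)
      rw [Finset.sum_range_succ]
      convert this using 1
      abel
  have hlast := hind N le_rfl
  have h0 : KZ.of r - KZ.of (r.restrict _ (hDsa N) (hDsub N le_rfl)) ∈ M₁ := by
    refine of_sub_of_mem_of_eqOn _ _ ?_ fun _ _ => rfl
    show {z : Fin 1 → ℝ | z 0 ∈ Ioo (0 : ℝ) ((N : ℝ) / N)} = r.domain
    rw [div_self hN'.ne', hr]
  have := M₁.add_mem h0 hlast
  rwa [sub_add_sub_cancel] at this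

/-- The affine map `t ↦ N t − q` carries `(q/N, (q+1)/N)` onto `(0,1)`. [folklore] -/
theorem image_affine_piece {N : ℕ} (hN : 0 < N) (q : ℕ) :
    (fun p : Fin 1 → ℝ => fun _ : Fin 1 => (N : ℝ) * p 0 - q) ''
        {z : Fin 1 → ℝ | z 0 ∈ Ioo ((q : ℝ) / N) (((q : ℝ) + 1) / N)} =
      {z : Fin 1 → ℝ | z 0 ∈ Set.Ioo (0 : ℝ) 1} := by
  have hN' : (0 : ℝ) < N := by exact_mod_cast hN
  ext w
  constructor
  · rintro ⟨p, hp, rfl⟩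
    have hp' : p 0 ∈ Ioo ((q : ℝ) / N) (((q : ℝ) + 1) / N) := hp
    rw [mem_Ioo, div_lt_iff₀ hN', lt_div_iff₀ hN'] at hp'
    show (N : ℝ) * p 0 - q ∈ Ioo (0 : ℝ) 1
    constructor <;> nlinarith [hp'.1, hp'.2]
  · intro hw
    have hw' : w 0 ∈ Ioo (0 : ℝ) 1 := hw
    refine ⟨fun _ => (w 0 + q) / N, ?_, ?_⟩
    · show (w 0 + q) / N ∈ Ioo ((q : ℝ) / N) (((q : ℝ) + 1) / N)
      exact ⟨div_lt_div_of_pos_right (by linarith [hw'.1]) hN',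
        div_lt_div_of_pos_right (by linarith [hw'.2]) hN'⟩
    · funext i
      rw [Subsingleton.elim i 0]
      field_simp
      ring

/-- **One piece, reparametrised** (rule 2 with `φ(t) = N t − q`, `|φ′| = N`): for `q < N`,
`[r|_{(q/N,(q+1)/N)}] − [R] ∈ M₁` whenever `R` has domain `(0,1)` and integrand
`u ↦ r.integrand((q + u)/N) / N`. [cite: KontsevichZagier2001, §1.2 rule (2)] -/
theorem of_restrict_sub_of_mem (r : KZ.IntegralRep 1) {N : ℕ} (hN : 0 < N) {q : ℕ}
    (hsa : IsSemialgebraic ℚ {z : Fin 1 → ℝ | z 0 ∈ Ioo ((q : ℝ) / N) (((q : ℝ) + 1) / N)})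
    (hsub : {z : Fin 1 → ℝ | z 0 ∈ Ioo ((q : ℝ) / N) (((q : ℝ) + 1) / N)} ⊆ r.domain)
    (R : KZ.IntegralRep 1) (hRd : R.domain = {z | z 0 ∈ Set.Ioo (0 : ℝ) 1})
    (hRi : ∀ w ∈ R.domain, R.integrand w = r.integrand (fun _ => ((q : ℝ) + w 0) / N) / N) :
    KZ.of (r.restrict _ hsa hsub) - KZ.of R ∈ M₁ := by
  have hN' : (0 : ℝ) < N := by exact_mod_cast hN
  set r' := r.restrict _ hsa hsub with hr'
  -- rule 2 along `φ(t) = N t − q`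
  obtain ⟨s, hsd, hsi, hrel⟩ :=
    Summit.KontsevichZagierPeriods.HermiteRigidity.GenusTwoCycleTransfer.stub_pushforwardDimOne r'
      (fun t => (N : ℝ) * t - q) (fun _ => (N : ℝ)) (fun w _ => (w 0 + q) / N)
      ((isSemialgebraicFunOn_aeval hsa (MvPolynomial.C (N : ℚ) * MvPolynomial.X (0 : Fin 1) -
        MvPolynomial.C (q : ℚ) : MvPolynomial (Fin 1) ℚ)).congr fun z _ => by
          simp only [map_sub, map_mul, MvPolynomial.aeval_C, MvPolynomial.aeval_X, eq_ratCast]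
          push_cast; ring)
      (isSemialgebraicFunOn_const_natCast hsa N)
      (fun p _ => by
        simpa using ((hasDerivAt_id (p 0)).const_mul (N : ℝ)).sub_const (q : ℝ))
      (fun _ _ => hN'.ne')
      (by
        rw [show r'.domain = {z : Fin 1 → ℝ | z 0 ∈ Ioo ((q : ℝ) / N) (((q : ℝ) + 1) / N)} from rfl,
          image_affine_piece hN q]
        refine (isSemialgebraicMapOn_aeval isSemialgebraic_unitDom (fun _ : Fin 1 =>
          (MvPolynomial.C ((1 : ℚ) / N) * (MvPolynomial.X (0 : Fin 1) + MvPolynomial.C (q : ℚ)) :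
            MvPolynomial (Fin 1) ℚ))).congr fun w _ => ?_
        funext j
        simp only [map_add, map_mul, MvPolynomial.aeval_C, MvPolynomial.aeval_X, eq_ratCast]
        push_cast
        ring)
      (fun p _ => by
        funext i
        rw [Subsingleton.elim i 0]
        field_simp
        ring)
  have hsd' : s.domain = {z | z 0 ∈ Set.Ioo (0 : ℝ) 1} := by
    rw [hsd, show r'.domain = {z : Fin 1 → ℝ | z 0 ∈ Ioo ((q : ℝ) / N) (((q : ℝ) + 1) / N)}
      from rfl, image_affine_piece hN q]
  have h2 : KZ.of s - KZ.of R ∈ M₁ := by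
    refine of_sub_of_mem_of_eqOn s R (hRd.trans hsd'.symm) fun w hw => ?_
    rw [hsd'] at hw
    have hw' : w 0 ∈ Ioo (0 : ℝ) 1 := hw
    -- `w = φ p` with `p = ((w 0 + q)/N)`
    set p : Fin 1 → ℝ := fun _ => (w 0 + q) / N with hp
    have hpmem : p ∈ r'.domain := by
      show (w 0 + q) / N ∈ Ioo ((q : ℝ) / N) (((q : ℝ) + 1) / N)
      exact ⟨div_lt_div_of_pos_right (by linarith [hw'.1]) hN',
        div_lt_div_of_pos_right (by linarith [hw'.2]) hN'⟩
    have hwp : w = fun _ => (N : ℝ) * p 0 - q := by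
      funext i
      rw [Subsingleton.elim i 0, hp]
      field_simp
      ring
    rw [hRi w (by rw [hRd]; exact hw), hwp, hsi p hpmem, abs_of_pos hN']
    show r.integrand p / N = r.integrand (fun _ => ((q : ℝ) + ((N : ℝ) * p 0 - q)) / N) / N
    congr 2
    funext i
    rw [Subsingleton.elim i 0, hp]
    field_simp
    ring
  have := M₁.add_mem (changeOfVariablesRel_subset hrel) h2
  rwa [sub_add_sub_cancel] at this

/-- `q/N + t/N ∈ (0,1)` for `q < N`, `t ∈ (0,1)`. [folklore] -/
theorem div_add_div_mem_Ioo {q N : ℕ} (hN : 0 < N) (hq : q < N) {t : ℝ} (ht : t ∈ Ioo (0 : ℝ) 1) :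
    (q : ℝ) / N + t / N ∈ Ioo (0 : ℝ) 1 := by
  have hN' : (0 : ℝ) < N := by exact_mod_cast hN
  have hq' : (q : ℝ) + 1 ≤ N := by exact_mod_cast hq
  constructor
  · have := ht.1; positivity
  · rw [← add_div, div_lt_one hN']
    linarith [ht.2]

/-- **The chain rule for a grid piece**: the realisation integrand of `t ↦ e(q/N + t/N)` at `u` is
`1/N` times the realisation integrand of `e` at `q/N + u/N`. [folklore] -/
theorem integrand_piece {n : ℕ} (ω : Fin n → MvPolynomial (Fin n) ℂ) (a : ℂ) {e : ℝ → (Fin n → ℂ)}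
    (he : ContDiffOn ℝ 1 e (Icc 0 1)) {N : ℕ} (hN : 0 < N) {q : ℕ} (hq : q < N) {u : ℝ}
    (hu : u ∈ Ioo (0 : ℝ) 1) :
    (a * ∑ i, MvPolynomial.eval (e ((q : ℝ) / N + u / N)) (ω i) *
        deriv (fun v => e ((q : ℝ) / N + v / N) i) u).re =
      (a * ∑ i, MvPolynomial.eval (e ((q : ℝ) / N + u / N)) (ω i) *
        deriv (fun v => e v i) ((q : ℝ) / N + u / N)).re / N := by
  have hmem := div_add_div_mem_Ioo hN hq hu
  have hderiv : ∀ i, deriv (fun v => e ((q : ℝ) / N + v / N) i) u =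
      (((1 : ℝ) / N : ℝ) : ℂ) * deriv (fun v => e v i) ((q : ℝ) / N + u / N) := by
    intro i
    have h1 := hasDerivAt_coord he hmem i
    have h2 : HasDerivAt (fun v : ℝ => (q : ℝ) / N + v / N) ((1 : ℝ) / N) u :=
      ((hasDerivAt_id u).div_const (N : ℝ)).const_add _
    have h3 : HasDerivAt ((fun v => e v i) ∘ fun v : ℝ => (q : ℝ) / N + v / N)
        (((1 : ℝ) / N) • deriv (fun v => e v i) ((q : ℝ) / N + u / N)) u := h1.scomp u h2
    have h4 : deriv (fun v => e ((q : ℝ) / N + v / N) i) u =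
        ((1 : ℝ) / N) • deriv (fun v => e v i) ((q : ℝ) / N + u / N) := h3.deriv
    rw [h4, Complex.real_smul]
  simp_rw [hderiv]
  have hsum : ∑ i, MvPolynomial.eval (e ((q : ℝ) / N + u / N)) (ω i) *
      ((((1 : ℝ) / N : ℝ) : ℂ) * deriv (fun v => e v i) ((q : ℝ) / N + u / N)) =
      (((1 : ℝ) / N : ℝ) : ℂ) * ∑ i, MvPolynomial.eval (e ((q : ℝ) / N + u / N)) (ω i) *
        deriv (fun v => e v i) ((q : ℝ) / N + u / N) := by
    rw [Finset.mul_sum]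
    exact Finset.sum_congr rfl fun i _ => by ring
  rw [hsum, ← mul_assoc, mul_comm a, mul_assoc, Complex.re_ofReal_mul]
  ring

/-- **A realisation is the sum of the realisations of its grid pieces, modulo `M₁`** (rule 1a at the
cut points `q/N`, then the affine rule 2 on each piece). [cite: KontsevichZagier2001, §1.2 rules (1), (2)] -/
theorem of_sub_sum_pieces_mem {n : ℕ} (ω : Fin n → MvPolynomial (Fin n) ℂ) (a : ℂ)
    {e : ℝ → (Fin n → ℂ)} (he : ContDiffOn ℝ 1 e (Icc 0 1)) {N : ℕ} (hN : 0 < N)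
    (r : KZ.IntegralRep 1)
    (hr : r.domain = {z | z 0 ∈ Set.Ioo (0 : ℝ) 1} ∧ ∀ z ∈ r.domain, r.integrand z =
      (a * ∑ i, MvPolynomial.eval (e (z 0)) (ω i) * deriv (fun u => e u i) (z 0)).re)
    (R : ℕ → KZ.IntegralRep 1)
    (hR : ∀ q, q < N → (R q).domain = {z | z 0 ∈ Set.Ioo (0 : ℝ) 1} ∧ ∀ z ∈ (R q).domain,
      (R q).integrand z = (a * ∑ i, MvPolynomial.eval (e ((q : ℝ) / N + z 0 / N)) (ω i) *
        deriv (fun u => e ((q : ℝ) / N + u / N) i) (z 0)).re) :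
    KZ.of r - ∑ q ∈ Finset.range N, KZ.of (R q) ∈ M₁ := by
  classical
  have hN' : (0 : ℝ) < N := by exact_mod_cast hN
  have hsa : ∀ q : ℕ, IsSemialgebraic ℚ
      {z : Fin 1 → ℝ | z 0 ∈ Ioo ((q : ℝ) / N) (((q : ℝ) + 1) / N)} := by
    intro q
    have := isSemialgebraic_IooSet ((q : ℚ) / N) (((q : ℚ) + 1) / N)
    push_cast at this
    exact this
  have hsub : ∀ q, q < N →
      {z : Fin 1 → ℝ | z 0 ∈ Ioo ((q : ℝ) / N) (((q : ℝ) + 1) / N)} ⊆ r.domain := by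
    intro q hq
    rw [hr.1]
    exact IooSet_piece_subset hN hq
  set piece : ℕ → KZ.IntegralRep 1 := fun q =>
    if hq : q < N then r.restrict _ (hsa q) (hsub q hq) else r with hpiece
  have hpiece' : ∀ q (hq : q < N), piece q = r.restrict _ (hsa q) (hsub q hq) := fun q hq => by
    simp only [hpiece, dif_pos hq]
  have h1 := of_sub_sum_restrict_mem r hr.1 hN hsa hsub piece hpiece'
  have h2 : ∀ q ∈ Finset.range N, KZ.of (piece q) - KZ.of (R q) ∈ M₁ := by
    intro q hq
    rw [Finset.mem_range] at hq
    rw [hpiece' q hq]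
    refine of_restrict_sub_of_mem r hN (hsa q) (hsub q hq) (R q) (hR q hq).1 fun w hw => ?_
    have hw' : w 0 ∈ Ioo (0 : ℝ) 1 := by
      have := hw; rw [(hR q hq).1] at this; exact this
    have hmem := div_add_div_mem_Ioo hN hq hw'
    have hp : (fun _ : Fin 1 => ((q : ℝ) + w 0) / N) ∈ r.domain := by
      rw [hr.1]
      show ((q : ℝ) + w 0) / N ∈ Ioo (0 : ℝ) 1
      rw [add_div]
      exact hmem
    rw [(hR q hq).2 w hw, hr.2 _ hp]
    simp only [add_div]
    exact integrand_piece ω a he hN hq hw'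
  have h3 : ∑ q ∈ Finset.range N, (KZ.of (piece q) - KZ.of (R q)) ∈ M₁ := sum_mem h2
  have := M₁.add_mem h1 h3
  convert this using 1
  rw [Finset.sum_sub_distrib]
  abel

end Summit.KontsevichZagierPeriods.SymplecticScissors.RealOnePeriodRelations.HomotopyInvariance

namespace Summit.KontsevichZagierPeriods.SymplecticScissors.RealOnePeriodRelations

/-- **Registered anchor `helper_homotopyInvariance_2` (THE SIDES OF THE GRID).** A realisation of
`a · ω` along a `C¹` path `e` on `(0,1)` is congruent modulo `M₁` to the sum of the realisations along
its `N` grid pieces `t ↦ e(q/N + t/N)` (rule 1a at the cut points, affine rule 2 on each piece).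
[cite: KontsevichZagier2001, §1.2 rules (1), (2)] -/
theorem helper_homotopyInvariance_2 : ∀ (n : ℕ) (ω : Fin n → MvPolynomial (Fin n) ℂ) (a : ℂ) (e : ℝ → (Fin n → ℂ)), ContDiffOn ℝ 1 e (Set.Icc 0 1) → ∀ (N : ℕ), 0 < N → ∀ (r : KZ.IntegralRep 1), (r.domain = {z | z 0 ∈ Set.Ioo (0 : ℝ) 1} ∧ ∀ z ∈ r.domain, r.integrand z = (a * ∑ i, MvPolynomial.eval (e (z 0)) (ω i) * deriv (fun u => e u i) (z 0)).re) → ∀ (R : ℕ → KZ.IntegralRep 1), (∀ q, q < N → (R q).domain = {z | z 0 ∈ Set.Ioo (0 : ℝ) 1} ∧ ∀ z ∈ (R q).domain, (R q).integrand z = (a * ∑ i, MvPolynomial.eval (e ((q : ℝ) / N + z 0 / N)) (ω i) * deriv (fun u => e ((q : ℝ) / N + u / N) i) (z 0)).re) → KZ.of r - ∑ q ∈ Finset.range N, KZ.of (R q) ∈ M₁ :=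
  fun _ ω a _ he _ hN r hr R hR => HomotopyInvariance.of_sub_sum_pieces_mem ω a he hN r hr R hR

end Summit.KontsevichZagierPeriods.SymplecticScissors.RealOnePeriodRelations

end
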